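import Summits.CriticalPhenomena.CardyFormulaZ2.Theorems.CardyUniqueLimitCardyRigidityLoewnerKit2
import Summits.CriticalPhenomena.CardyFormulaZ2.Theorems.CardyUniqueLimitCardyRigidityLoewnerKit4
import Summits.CriticalPhenomena.CardyFormulaZ2.Theorems.CardyUniqueLimitCardyRigidityLoewnerKit5
import HarnessLib

/-!
# Loewner–Carathéodory convergence kit, VI: sequential forms for the compactness assembly

Crux `Summit.CriticalPhenomena.CardyFormulaZ2.Theses.CardyUniqueLimit.CardyRigidity`
(stmt-CriticalPhenomena-0746), line `crossing_martingale`, helper kit for the registered stub A3b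
`stub_slitObservableApprox`.  Kits I, II, IV, V state the convergence of the Loewner maps, inverse
maps, boundary extensions, real flows and hull-image ends as CONTINUITY in
`(t, w) ∈ ℝ≥0 × C([0,∞), ℝ)` (filters `𝓝 (t₀, w₀)`).  The assembly of A3b argues by contradiction
along a subsequence of the Kemppainen–Smirnov box on which `W_k → W` locally uniformly and the
capacity times `t_k → t`; this file spells out the corresponding SEQUENTIAL (any filter) forms:
along `(t_k, W_k) → (t, W)`,

* `tendstoUniformlyOn_loewnerInv_seq` — `f^{W_k}_{t_k} → f^{W}_t` uniformly on `{im ≥ y}`;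
* `tendstoUniformlyOn_map_seq` — `g^{W_k}_{t_k} → g^{W}_t` uniformly on a compact alive set, which
  stays alive;
* `exists_ball_tendstoUniformlyOn_bdryInv_seq` — `f̄^{W_k}_{t_k} → f̄^{W}_t` uniformly on a closed
  half-disc about the image of an alive point of the closed half-plane;
* `tendsto_realFlowStop_seq` — `X^y_{t_k}(W_k) → X^y_t(W)` for `y` alive at `t` under `W`;
* `eventually_rightEnd_lt_seq`, `eventually_lt_leftEnd_seq` — semicontinuity of the ends of the
  image of the hull;

through the index-change lemma `tendstoUniformlyOn_of_tendsto_index`.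

References: Lawler (2005) §4.7; Lawler–Schramm–Werner (2004) Lemma 3.14; Kemppainen–Smirnov (2017)
App. A Lemma 5.4; Pommerenke (1992) Cor. 2.4.
-/

noncomputable section

open Set Filter Topology Metric
open scoped NNReal
open UpperHalfPlane (upperHalfPlaneSet)
open Literature.Probability.RandomPlanarGeometry Literature.Probability.RandomPlanarGeometry.Loewner

namespace Summit.CriticalPhenomena.CardyFormulaZ2.Cruxes.CardyRigidity.CrossingMartingale

namespace LoewnerKit

/-- **Index change in uniform convergence**: if `F_n → f` uniformly on `s` along `p` and
`u : κ → ι` tends to `p` along `l`, then `F_{u k} → f` uniformly on `s` along `l`. [folklore] -/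
theorem tendstoUniformlyOn_of_tendsto_index {ι κ α β : Type*} [UniformSpace β] {F : ι → α → β}
    {f : α → β} {p : Filter ι} {s : Set α} (h : TendstoUniformlyOn F f p s) {l : Filter κ}
    {u : κ → ι} (hu : Tendsto u l p) : TendstoUniformlyOn (fun k ↦ F (u k)) f l s :=
  fun U hU ↦ hu.eventually (h U hU)

variable {ι : Type*} {l : Filter ι} {tk : ι → ℝ≥0} {wk : ι → C(ℝ≥0, ℝ)} {t : ℝ≥0} {w : C(ℝ≥0, ℝ)}

/-- The pair `(t_k, W_k)` tends to `(t, W)` in the product. [folklore] -/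
theorem tendsto_prodMk (ht : Tendsto tk l (𝓝 t)) (hw : Tendsto wk l (𝓝 w)) :
    Tendsto (fun k ↦ (tk k, wk k)) l (𝓝 (t, w)) :=
  ht.prodMk_nhds hw

/-- **(L1, sequential) `f^{W_k}_{t_k} → f^{W}_t` uniformly on `{im ≥ y}`** along
`(t_k, W_k) → (t, W)` (`W_k → W` locally uniformly), for every `y > 0`.
[cite: LawlerSchrammWerner2004, Lemma 3.14] -/
theorem tendstoUniformlyOn_loewnerInv_seq (ht : Tendsto tk l (𝓝 t)) (hw : Tendsto wk l (𝓝 w))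
    {y : ℝ} (hy : 0 < y) :
    TendstoUniformlyOn (fun k z ↦ loewnerInv (wk k) (tk k) z) (loewnerInv w t) l
      {z : ℂ | y ≤ z.im} := by
  have h := tendstoUniformlyOn_of_tendsto_index (tendstoUniformlyOn_loewnerInv_nhds (t, w) hy)
    (tendsto_prodMk ht hw)
  exact h

/-- **(L1/L3, sequential) `g^{W_k}_{t_k} → g^{W}_t` uniformly on a compact alive set**, which stays
alive, along `(t_k, W_k) → (t, W)`. [cite: KemppainenSmirnov2017, App. A, Lemma 5.4] -/
theorem tendstoUniformlyOn_map_seq (ht : Tendsto tk l (𝓝 t)) (hw : Tendsto wk l (𝓝 w))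
    {K : Set ℂ} (hK : IsCompact K) (hKt : ∀ z ∈ K, (t : WithTop ℝ≥0) < swallowingTime w z) :
    (∀ᶠ k in l, ∀ z ∈ K, (tk k : WithTop ℝ≥0) < swallowingTime (wk k) z) ∧
      TendstoUniformlyOn (fun k z ↦ map (wk k) (tk k) z) (map w t) l K := by
  obtain ⟨halive, hconv⟩ := tendstoUniformlyOn_map_nhds (t, w) hK hKt
  have h1 := (tendsto_prodMk ht hw).eventually halive
  have h2 := tendstoUniformlyOn_of_tendsto_index hconv (tendsto_prodMk ht hw)
  exact ⟨h1, h2⟩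

/-- **(L3, sequential) `f̄^{W_k}_{t_k} → f̄^{W}_t` uniformly on a closed half-disc** about the image
`v₀ = g^{W}_t(z₀)` of an alive point `z₀` of the closed upper half-plane, along
`(t_k, W_k) → (t, W)`; with `f̄^{W}_t(v₀) = z₀` and `f̄^{W}_t` continuous there.
[cite: PommerenkeBBCM1992, Cor. 2.4] -/
theorem exists_ball_tendstoUniformlyOn_bdryInv_seq (ht : Tendsto tk l (𝓝 t))
    (hw : Tendsto wk l (𝓝 w)) {z₀ : ℂ} (hz₀ : (t : WithTop ℝ≥0) < swallowingTime w z₀)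
    (hz₀' : 0 ≤ z₀.im) :
    ∃ ρ > (0 : ℝ), bdryInv w t (map w t z₀) = z₀ ∧
      ContinuousOn (bdryInv w t) (closedBall (map w t z₀) ρ ∩ {v : ℂ | 0 ≤ v.im}) ∧
      TendstoUniformlyOn (fun k v ↦ bdryInv (wk k) (tk k) v) (bdryInv w t) l
        (closedBall (map w t z₀) ρ ∩ {v : ℂ | 0 ≤ v.im}) := by
  obtain ⟨ρ, hρ, h0, hc, hconv⟩ := exists_ball_tendstoUniformlyOn_bdryInv_nhds (t, w) hz₀ hz₀'
  have h := tendstoUniformlyOn_of_tendsto_index hconv (tendsto_prodMk ht hw)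
  exact ⟨ρ, hρ, h0, hc, h⟩

/-- The same on the open upper part, for the inverse maps themselves. [cite: PommerenkeBBCM1992, Cor. 2.4] -/
theorem exists_ball_tendstoUniformlyOn_loewnerInv_seq (ht : Tendsto tk l (𝓝 t))
    (hw : Tendsto wk l (𝓝 w)) {z₀ : ℂ} (hz₀ : (t : WithTop ℝ≥0) < swallowingTime w z₀)
    (hz₀' : 0 ≤ z₀.im) :
    ∃ ρ > (0 : ℝ), TendstoUniformlyOn (fun k v ↦ loewnerInv (wk k) (tk k) v) (loewnerInv w t) l
      (closedBall (map w t z₀) ρ ∩ upperHalfPlaneSet) := by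
  obtain ⟨ρ, hρ, hconv⟩ := exists_ball_tendstoUniformlyOn_loewnerInv_nhds (t, w) hz₀ hz₀'
  have h := tendstoUniformlyOn_of_tendsto_index hconv (tendsto_prodMk ht hw)
  exact ⟨ρ, hρ, h⟩

/-- **(L2, sequential) `X^y_{t_k}(W_k) → X^y_t(W)`** for a real point `y` alive at time `t` under
`W`, along `(t_k, W_k) → (t, W)`. [cite: Lawler2005, Ch. 4 §4.7 (Prop. 4.47)] -/
theorem tendsto_realFlowStop_seq (ht : Tendsto tk l (𝓝 t)) (hw : Tendsto wk l (𝓝 w)) {y : ℝ}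
    (hy : (t : WithTop ℝ≥0) < swallowingTime w y) :
    Tendsto (fun k ↦ realFlowStop (wk k) y (tk k)) l (𝓝 (realFlowStop w y t)) := by
  have h := (continuousAt_realFlowStop_prod hy).tendsto.comp (tendsto_prodMk ht hw)
  exact h

/-- **(L3, sequential) upper semicontinuity of the right end of the image of the hull**:
eventually `a⁺(t_k, W_k) < a⁺(t, W) + ε`. [cite: KemppainenSmirnov2017, App. A, Lemma 5.4] -/
theorem eventually_rightEnd_lt_seq (ht : Tendsto tk l (𝓝 t)) (hw : Tendsto wk l (𝓝 w)) {ε : ℝ}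
    (hε : 0 < ε) :
    ∀ᶠ k in l,
      sInf ((fun x : ℝ ↦ (map (wk k) (tk k) x).re) ''
          {x : ℝ | wk k 0 < x ∧ (tk k : WithTop ℝ≥0) < swallowingTime (wk k) x}) <
        sInf ((fun x : ℝ ↦ (map w t x).re) ''
          {x : ℝ | w 0 < x ∧ (t : WithTop ℝ≥0) < swallowingTime w x}) + ε := by
  have h := (tendsto_prodMk ht hw).eventually (eventually_rightEnd_lt (t, w) hε)
  exact h

/-- **(L3, sequential) lower semicontinuity of the left end of the image of the hull**:
eventually `a⁻(t, W) - ε < a⁻(t_k, W_k)`. [cite: KemppainenSmirnov2017, App. A, Lemma 5.4] -/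
theorem eventually_lt_leftEnd_seq (ht : Tendsto tk l (𝓝 t)) (hw : Tendsto wk l (𝓝 w)) {ε : ℝ}
    (hε : 0 < ε) :
    ∀ᶠ k in l,
      sSup ((fun x : ℝ ↦ (map w t x).re) ''
          {x : ℝ | x < w 0 ∧ (t : WithTop ℝ≥0) < swallowingTime w x}) - ε <
        sSup ((fun x : ℝ ↦ (map (wk k) (tk k) x).re) ''
          {x : ℝ | x < wk k 0 ∧ (tk k : WithTop ℝ≥0) < swallowingTime (wk k) x}) := by
  have h := (tendsto_prodMk ht hw).eventually (eventually_lt_leftEnd (t, w) hε)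
  exact h

/-- **(L3, sequential) an alive real point stays alive with converging image**: for `x` alive at
`t` under `W`, eventually `x` is alive at `t_k` under `W_k`, and `re g^{W_k}_{t_k}(x) → re g^{W}_t(x)`.
[cite: KemppainenSmirnov2017, App. A, Lemma 5.4] -/
theorem tendsto_map_ofReal_re_seq (ht : Tendsto tk l (𝓝 t)) (hw : Tendsto wk l (𝓝 w)) {x : ℝ}
    (hx : (t : WithTop ℝ≥0) < swallowingTime w x) :
    (∀ᶠ k in l, (tk k : WithTop ℝ≥0) < swallowingTime (wk k) x) ∧
      Tendsto (fun k ↦ (map (wk k) (tk k) x).re) l (𝓝 ((map w t x).re)) := by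
  obtain ⟨halive, hconv⟩ := tendstoUniformlyOn_map_seq ht hw (isCompact_singleton (x := (x : ℂ)))
    (fun z hz ↦ by rw [mem_singleton_iff.1 hz]; exact hx)
  refine ⟨halive.mono fun k hk ↦ hk _ (mem_singleton _), ?_⟩
  exact (Complex.continuous_re.tendsto _).comp (hconv.tendsto_at (mem_singleton _))

end LoewnerKit

/-- **Registered form** (anchor `loewnerKit_tendstoUniformlyOn_map_seq` of stmt-CriticalPhenomena-0746): along
`(t_k, W_k) → (t, W)` (any filter; `W_k → W` locally uniformly) the Loewner maps converge uniformly on every compact set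
of points alive at time `t` under `W`, which stays alive. [cite: KemppainenSmirnov2017, App. A, Lemma 5.4] -/
theorem loewnerKit_tendstoUniformlyOn_map_seq : ∀ {ι : Type*} {l : Filter ι} {tk : ι → NNReal} {wk : ι → ContinuousMap NNReal ℝ} {t : NNReal} {w : ContinuousMap NNReal ℝ}, Filter.Tendsto tk l (nhds t) → Filter.Tendsto wk l (nhds w) → ∀ {K : Set ℂ}, IsCompact K → (∀ z ∈ K, (t : WithTop NNReal) < Literature.Probability.RandomPlanarGeometry.Loewner.swallowingTime (⇑w) z) → (∀ᶠ k in l, ∀ z ∈ K, (tk k : WithTop NNReal) < Literature.Probability.RandomPlanarGeometry.Loewner.swallowingTime (⇑(wk k)) z) ∧ TendstoUniformlyOn (fun k z ↦ Literature.Probability.RandomPlanarGeometry.Loewner.map (⇑(wk k)) (tk k) z) (Literature.Probability.RandomPlanarGeometry.Loewner.map (⇑w) t) l K :=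
  fun ht hw _ hK hKt ↦ LoewnerKit.tendstoUniformlyOn_map_seq ht hw hK hKt

end Summit.CriticalPhenomena.CardyFormulaZ2.Cruxes.CardyRigidity.CrossingMartingale

end
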